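import Summits.RiemannHypothesis.RiemannHypothesis.Theses.RuelleBand

/-!
# RiemannHypothesis / RuelleBand — the assembly `Assembly` (thesis X ⇒ RH)

Route `RiemannHypothesis/RuelleBand`, item stmt-RiemannHypothesis-2070 (`Assembly`, rank 1):

  `ExactFirstBand → Summit.RiemannHypothesis`,

where `ExactFirstBand` is thesis X of the route (EXACT FIRST BAND, Dyatlov–Faure–Guillarmou
shape): every zero `s` of `ζ` with `0 < re s < 1` has `re s = 1/2` or `im s = 0`.

The implication is, verbatim, the route file's kernel-checked deciding theorem
`Summit.RiemannHypothesis.RiemannHypothesis.Theses.RuelleBand.closes : ExactFirstBand →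
Summit.RiemannHypothesis` (rev 5, sorry-free, Mathlib + `Literature.NumberTheory.LFunctions.
ZetaRealAxis` cone): for a zero `s` of `ζ` that is not trivial and not `1`, `re s < 1` by
`riemannZeta_ne_zero_of_one_le_re` (Hadamard–de la Vallée Poussin, Mathlib), `0 < re s` because a
zero with `re s ≤ 0` is trivial (functional equation `riemannZeta_one_sub`), X gives `re s = 1/2`
or `im s = 0`, and a real zero of the open strip contradicts `ζ(σ) < 0` on `(0,1)`
(`Literature.NumberTheory.LFunctions.riemannZeta_ne_zero_of_im_eq_zero_of_pos_of_lt_one`,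
Titchmarsh §2.12). So the assembly closes by that theorem.

References: S. Dyatlov, F. Faure, C. Guillarmou, *Power spectrum of the geodesic flow on
hyperbolic manifolds*, Anal. PDE 8 (2015), Thm 2 and Remark (i); E. C. Titchmarsh, *The theory of
the Riemann zeta-function*, §2.12.
-/

namespace Summit.RiemannHypothesis.RiemannHypothesis.Theorems

/-- **Assembly of route RuelleBand** (item stmt-RiemannHypothesis-2070): thesis X — every zero of
`ζ` in the open critical strip lies on the critical line or on the real axis — implies the Riemann
Hypothesis (`Summit.RiemannHypothesis`). The hypothesis is literally the route thesis
`ExactFirstBand`, and the implication is the route's proved deciding theorem `closes` (no zeros on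
`re s ≥ 1` and none with `re s ≤ 0` except the trivial ones, Mathlib; no real zeros in `(0,1)`,
`Literature.NumberTheory.LFunctions.riemannZeta_ne_zero_of_im_eq_zero_of_pos_of_lt_one`).
[DyatlovFaureGuillarmou2015, Thm 2, Remark (i); Titchmarsh1986 §2.12] -/
theorem ruelleBandAssembly_proof :
    Summit.RiemannHypothesis.RiemannHypothesis.Theses.RuelleBand.Assembly := by
  unfold Summit.RiemannHypothesis.RiemannHypothesis.Theses.RuelleBand.Assembly
  exact Summit.RiemannHypothesis.RiemannHypothesis.Theses.RuelleBand.closes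

end Summit.RiemannHypothesis.RiemannHypothesis.Theorems
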